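import Summits.ValiantsHypothesis.ValiantsHypothesis.Theorems.LacunarySymmetroidMatrixDescartesCensusDoorA34Coeffs
import Summits.ValiantsHypothesis.ValiantsHypothesis.Theorems.LacunarySymmetroidMatrixDescartesCensusGardingGram
import Summits.ValiantsHypothesis.ValiantsHypothesis.Theorems.LacunarySymmetroidMatrixDescartesCensusGardingDictionary

/-!
# `MatrixDescartes` census — DOOR A at `(3,4)`: the LP34 replay KIT (Gårding rows in coefficient currency, sign flip, assembly)

HONEST FRAMING.  Object-search cell `pub-symmetroid`; beside the OPEN typed statement `DoorA34 = PosRootLawAt 3 4 18`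
(route item `Theses.LacunarySymmetroid.DoorA34`, stmt-ValiantsHypothesis-19980), asserted nowhere.  Engine-2's LP34 certificates
(`HOME/engine-2/lp34/LP34-CERT.md`, `cert_3-4_<d>.json`) say, support by support, that a real symmetric `3 × 3` pencil
`det (∑ l, X^(d l) • S l)` with `19 = D(3,4)` distinct positive roots cannot have a DEFINITE letter in certain positions (on
`(0,1,7,11)`: in any position).  Their rows are kernel theorems of the tree already — F1 / C25 (`…CensusFullAlternation`,
`…CensusNewtonCone`), the `(3,4)` coefficient dictionary (`…CensusDoorA34Coeffs`, `…DoorA34Letters`) and the Gårding rows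
N1/N2/N3/G3 for a positive definite letter (`…CensusGardingRows/Dictionary/Lorentz/Gram`).  This file is the glue a
per-support replay needs and nothing more:

* `sumset_three_eq_tripleSums` — the `3`-fold sumset of `d` as an image over `Fin K × Fin K × Fin K` (so `decide` evaluates it);
* `trace_adjugate_mul_self_three`, `polar_trace_adjugate_mul_self` — `tr(adj P · P) = 3 det P` and the first-slot polarisation
  `tr(adj(P+X)·P) − tr(adj P·P) − tr(adj X·P) = 2 tr(adj P · X)` (`3 × 3`, any matrices);
* `garding_N1_coeff`, `garding_N2_coeff`, `garding_N3_coeff`, `garding_G3_coeff` — the rows N1/N2/N3/G3 restated in COEFFICIENT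
  CURRENCY: with `a = det P`, `bX = tr(adj P · X)`, `qX = tr(adj X · P)`, `m = tr((adj(X+Y) − adj X − adj Y) · P)` (the names under which
  the dictionary identifies them with coefficients `c_{3d_l}`, `c_{2d_l+d_j}`, `c_{d_l+2d_j}`, `c_{d_l+d_j+d_k}` of the pencil determinant):
  `3 a qX ≤ bX²`, `3 bX det X ≤ qX²`, `0 < qX → 4 qX qY ≤ m²`, `0 ≤ 12 a qX qY − 4 bX² qY − 4 bY² qX + 4 bX bY m − 3 a m²`;
* `pencil_neg`, `det_pencil_neg_three`, `posRoots_pencil_neg_three` — replacing every letter by its negative negates a `3 × 3` pencil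
  determinant and keeps its positive roots (the global sign symmetry `s ↦ −s` of LP34-CERT §2: a negative definite letter is the
  positive definite letter of the flipped pencil);
* `posRoots_le_18_of_forall_not_posDef` — assembly: if on a support `d` no letter of a `19`-root symmetric pencil can be positive
  definite, then every symmetric pencil on `d` with a definite (positive or negative) letter has `Z₊ ≤ 18`.

Rows for a DEFINITE letter only; nothing here on the all-indefinite residue of `DoorA34`, on `ζ_sym(3,4) ∈ {18, 19}`, on
`MatrixDescartes` (stmt-ValiantsHypothesis-18050) or `VP ≠ VNP`.

[folklore] Elementary identities and bookkeeping over the tree's Gårding rows.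
-/

-- `Summit.ValiantsHypothesis.ValiantsHypothesis.…` repeats a component by the D-0017 layout
-- (single-conjunct summit), which the `dupNamespace` linter flags; the name is mandated.
set_option linter.dupNamespace false

namespace Summit.ValiantsHypothesis.ValiantsHypothesis.Theorems.LacunarySymmetroidMatrixDescartes.Census

open Polynomial Matrix Finset
open scoped BigOperators Polynomial Matrix

/-- The `3`-fold sumset of `d` (sums over maps `Fin 3 → Fin K`) is the image of `Fin K × Fin K × Fin K` under
`(i,j,k) ↦ d i + d j + d k` — the computable form `decide` evaluates. [folklore] -/
theorem sumset_three_eq_tripleSums {K : ℕ} (d : Fin K → ℕ) :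
    (Finset.univ : Finset (Fin 3 → Fin K)).image (fun f => ∑ i, d (f i))
      = (Finset.univ : Finset (Fin K × Fin K × Fin K)).image (fun p => d p.1 + d p.2.1 + d p.2.2) := by
  ext e
  simp only [Finset.mem_image, Finset.mem_univ, true_and, Fin.sum_univ_three]
  constructor
  · rintro ⟨f, rfl⟩
    exact ⟨(f 0, f 1, f 2), rfl⟩
  · rintro ⟨p, rfl⟩
    exact ⟨![p.1, p.2.1, p.2.2], by simp⟩

/-- `tr(adj P · P) = 3 · det P` for a `3 × 3` matrix (`adj P · P = det P · 1`). [folklore] -/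
theorem trace_adjugate_mul_self_three (P : Matrix (Fin 3) (Fin 3) ℝ) : (P.adjugate * P).trace = 3 * P.det := by
  rw [Matrix.adjugate_mul, Matrix.trace_smul, Matrix.trace_one, Fintype.card_fin, smul_eq_mul]
  push_cast
  ring

/-- First-slot polarisation of `tr(adj · · P)` (`3 × 3`, any matrices): `tr(adj(P+X)·P) − tr(adj P·P) − tr(adj X·P) = 2 tr(adj P · X)`
(`= 6 D(P,P,X)`; symmetry of the mixed discriminant). [folklore] -/
theorem polar_trace_adjugate_mul_self (P X : Matrix (Fin 3) (Fin 3) ℝ) :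
    ((P + X).adjugate * P).trace - (P.adjugate * P).trace - (X.adjugate * P).trace = 2 * (P.adjugate * X).trace := by
  simp only [Matrix.adjugate_fin_three, Matrix.trace_fin_three, Matrix.mul_apply, Fin.sum_univ_three, Matrix.add_apply,
    Matrix.of_apply, Matrix.cons_val', Matrix.cons_val_zero, Matrix.cons_val_one, Matrix.head_cons, Matrix.cons_val_two,
    Matrix.tail_cons, Matrix.empty_val', Matrix.cons_val_fin_one, Matrix.head_fin_const]
  ring

/-- **Row N1 in coefficient currency**: for `P ≻ 0`, `Y` symmetric (`3 × 3`), with `a = det P`, `b = tr(adj P · Y)`, `c = tr(adj Y · P)`: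
`3 a c ≤ b²`. [folklore] -/
theorem garding_N1_coeff {P Y : Matrix (Fin 3) (Fin 3) ℝ} (hP : P.PosDef) (hY : Y.IsSymm) {a b c : ℝ}
    (ha : P.det = a) (hb : (P.adjugate * Y).trace = b) (hc : (Y.adjugate * P).trace = c) :
    3 * (a * c) ≤ b ^ 2 := by
  have h := garding_N1_trace hP hY
  rw [ha, hb, hc] at h
  exact h

/-- **Row N2 in coefficient currency**: for `P ≻ 0`, `Y` symmetric (`3 × 3`), with `b = tr(adj P · Y)`, `c = tr(adj Y · P)`, `e = det Y`:
`3 b e ≤ c²`. [folklore] -/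
theorem garding_N2_coeff {P Y : Matrix (Fin 3) (Fin 3) ℝ} (hP : P.PosDef) (hY : Y.IsSymm) {b c e : ℝ}
    (hb : (P.adjugate * Y).trace = b) (hc : (Y.adjugate * P).trace = c) (he : Y.det = e) :
    3 * (b * e) ≤ c ^ 2 := by
  have h := garding_N2_trace hP hY
  rw [hb, hc, he] at h
  exact h

/-- **Row N3 in coefficient currency** (reverse Cauchy–Schwarz): for `P ≻ 0`, `X, Y` symmetric (`3 × 3`), with `qX = tr(adj X · P)`,
`qY = tr(adj Y · P)`, `m = tr((adj(X+Y) − adj X − adj Y) · P)` and `qX > 0`: `4 qX qY ≤ m²`. [folklore] -/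
theorem garding_N3_coeff {P X Y : Matrix (Fin 3) (Fin 3) ℝ} (hP : P.PosDef) (hX : X.IsSymm) (hY : Y.IsSymm) {qX qY m : ℝ}
    (hqX : (X.adjugate * P).trace = qX) (hqY : (Y.adjugate * P).trace = qY)
    (hm : (((X + Y).adjugate - X.adjugate - Y.adjugate) * P).trace = m) (hq : 0 < qX) :
    4 * (qX * qY) ≤ m ^ 2 := by
  have h := garding_row_N3 hP hX hY (by rw [hqX]; exact hq)
  rw [Matrix.sub_mul, Matrix.sub_mul, Matrix.trace_sub, Matrix.trace_sub] at hm
  rw [hm, hqX, hqY] at h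
  exact h

/-- **Row G3 in coefficient currency** (Gram sign of `(P, X, Y)` under `b_P`): for `P ≻ 0`, `X, Y` symmetric (`3 × 3`), with
`a = det P`, `bX = tr(adj P · X)`, `bY = tr(adj P · Y)`, `qX = tr(adj X · P)`, `qY = tr(adj Y · P)`, `m = tr((adj(X+Y) − adj X − adj Y) · P)`:
`0 ≤ 12 a qX qY − 4 bX² qY − 4 bY² qX + 4 bX bY m − 3 a m²` (`= 108 ×` the Gram determinant `det [D(P,·,·)]` on `(P,X,Y)`). [folklore] -/
theorem garding_G3_coeff {P X Y : Matrix (Fin 3) (Fin 3) ℝ} (hP : P.PosDef) (hX : X.IsSymm) (hY : Y.IsSymm)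
    {a bX bY qX qY m : ℝ} (ha : P.det = a) (hbX : (P.adjugate * X).trace = bX) (hbY : (P.adjugate * Y).trace = bY)
    (hqX : (X.adjugate * P).trace = qX) (hqY : (Y.adjugate * P).trace = qY)
    (hm : (((X + Y).adjugate - X.adjugate - Y.adjugate) * P).trace = m) :
    0 ≤ 12 * (a * qX * qY) - 4 * (bX ^ 2 * qY) - 4 * (bY ^ 2 * qX) + 4 * (bX * bY * m) - 3 * (a * m ^ 2) := by
  have h := garding_row_G3 hP hX hY
  rw [Matrix.sub_mul, Matrix.sub_mul, Matrix.trace_sub, Matrix.trace_sub] at hm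
  rw [polar_trace_adjugate_mul_self P X, polar_trace_adjugate_mul_self P Y, trace_adjugate_mul_self_three, hm, ha, hbX,
    hbY, hqX, hqY] at h
  linarith

/-- Negating every letter negates the pencil matrix. [folklore] -/
theorem pencil_neg {K m : ℕ} (d : Fin K → ℕ) (S : Fin K → Matrix (Fin m) (Fin m) ℝ) :
    (∑ l, ((X : ℝ[X]) ^ d l) • (-S l).map C) = -(∑ l, ((X : ℝ[X]) ^ d l) • (S l).map C) := by
  rw [← Finset.sum_neg_distrib]
  refine Finset.sum_congr rfl fun l _ => ?_
  rw [Matrix.map_neg _ (fun a => C_neg) (S l), smul_neg]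

/-- Negating every letter of a `3 × 3` pencil negates its determinant. [folklore] -/
theorem det_pencil_neg_three {K : ℕ} (d : Fin K → ℕ) (S : Fin K → Matrix (Fin 3) (Fin 3) ℝ) :
    (∑ l, ((X : ℝ[X]) ^ d l) • (-S l).map C).det = -(∑ l, ((X : ℝ[X]) ^ d l) • (S l).map C).det := by
  rw [pencil_neg, Matrix.det_neg, Fintype.card_fin]
  norm_num

/-- … hence keeps the set of positive roots (the global sign symmetry `S ↦ −S` of LP34-CERT §2). [folklore] -/
theorem posRoots_pencil_neg_three {K : ℕ} (d : Fin K → ℕ) (S : Fin K → Matrix (Fin 3) (Fin 3) ℝ) :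
    ((∑ l, ((X : ℝ[X]) ^ d l) • (-S l).map C).det.roots.toFinset.filter (fun t => 0 < t))
      = ((∑ l, ((X : ℝ[X]) ^ d l) • (S l).map C).det.roots.toFinset.filter (fun t => 0 < t)) := by
  rw [det_pencil_neg_three, Polynomial.roots_neg]

/-- **Assembly.**  If on the support `d` no letter of a real symmetric `3 × 3` pencil with `≥ 19` distinct positive det-roots can be
POSITIVE definite, then (by the sign flip) none can be negative definite either, i.e. every real symmetric pencil on `d` with a
definite letter has at most `18` distinct positive det-roots. [folklore] -/
theorem posRoots_le_18_of_forall_not_posDef (d : Fin 4 → ℕ)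
    (h : ∀ (S : Fin 4 → Matrix (Fin 3) (Fin 3) ℝ), (∀ l, (S l).IsSymm) →
      19 ≤ ((∑ l, ((X : ℝ[X]) ^ d l) • (S l).map C).det.roots.toFinset.filter (fun t => 0 < t)).card →
      ∀ l, ¬ (S l).PosDef)
    (S : Fin 4 → Matrix (Fin 3) (Fin 3) ℝ) (hS : ∀ l, (S l).IsSymm) (hdef : ∃ l, (S l).PosDef ∨ (-S l).PosDef) :
    ((∑ l, ((X : ℝ[X]) ^ d l) • (S l).map C).det.roots.toFinset.filter (fun t => 0 < t)).card ≤ 18 := by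
  by_contra hlt
  have h19 : 19 ≤ ((∑ l, ((X : ℝ[X]) ^ d l) • (S l).map C).det.roots.toFinset.filter (fun t => 0 < t)).card := by omega
  obtain ⟨l, hl | hl⟩ := hdef
  · exact h S hS h19 l hl
  · refine h (fun l => -S l) (fun l => (hS l).neg) ?_ l hl
    rw [posRoots_pencil_neg_three]
    exact h19

end Summit.ValiantsHypothesis.ValiantsHypothesis.Theorems.LacunarySymmetroidMatrixDescartes.Census
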